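import Summits.QuantumFields.BalabanUV.T4Continuum.Spine.NE4.GaussianBlockSpectrum
import Summits.QuantumFields.BalabanUV.T4Continuum.Spine.NE4.AutonomousSchemeMargin

/-!
# Spine/NE4/GaussianBlockMargin — (R57)(ii) THE THREE NUMBERS OF THE IDEA ROAD IN THE ONE EXPLICIT MODEL: on the complexified Wick block of the
# hierarchical Gaussian linearisation, (R53)'s `Markov.StrictInward` HOLDS with norm = sup of Wick coordinates, ANY radius `ϱ`, margin
# `q = L⁻² + γ‖σ‖∕ϱ`; the margin road then returns NE4 at the Earle–Hamilton rate `2q∕(1+q) > L⁻²`, the direct computation of (R57) §5 at `L⁻²` itself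

Cell `pub-balaban-gaps` (YM blitz G2), seat `ne4`, generation 16 (unit `pub-balaban-gaps-ne4-g16`); record `HOME/ne/NE4.md` §5 (R57)(ii).

HONEST FRAMING.  NE4 = `T4CouplingMatching.ScaleShiftRate` is NOT IN PRINT ([Balaban1987RG1] = CMP **109** (1987) p. 264) and NOT proved.  Below: the affine caricature
of (R57) §5 (diagonal Gaussian factors `L^{4−n}`, `n ≥ 6`, plus a coupling-proportional one-step source) COMPLEXIFIED, run through (R53)'s hypothesis shape; elementary
norm arithmetic on `Fin m → ℂ`; nothing of Bałaban's asserted or instantiated; no status word moves (NE4 stays DEPENDENT; spine 0∕9).  One finite T⁴; NOT ℝ⁴, NOT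
infinite volume, NOT a mass gap, NOT Clay.

THE POINT.  (R53) (`AutonomousSchemeMargin`) reduced the idea road for Bałaban's RT to THREE NUMBERS — ONE norm on the complexified activities, ONE radius `ϱ`, ONE margin
`q < 1` (`Markov.StrictInward A ϱ q γ`: each step holomorphic on `ball 0 ϱ` with values in `closedBall 0 (qϱ)`) — and (R57) computed the road's LINEAR datum in the one model
where the Gaussian linearisation is explicit (Wick degree `n ↦ L^{4−n}`; `blockFactor_le_of_six_le`).  This file puts the two together:
* §1 `wickBlockStepC L deg σ g z = (blockFactor L (deg i) · z i + g·σ i)_i` on `Fin m → ℂ` — the complexification of (R57)'s `wickBlockStep` —, entire in `z`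
  (`differentiable_wickBlockStepC`), with `‖A g z‖ ≤ L⁻²·‖z‖ + γ·‖σ‖` for `1 ≤ L`, degrees `≥ 6`, `0 < g ≤ γ` (`norm_wickBlockStepC_le`).
* §2 **`strictInward_wickBlockC`**: for ANY radius `ϱ > 0` and any `q ≥ L⁻² + γ‖σ‖∕ϱ`, `Markov.StrictInward (wickBlockStepC L deg σ) ϱ q γ` — the three numbers of the
  idea road COMPUTED in the model: (sup norm on complexified Wick coordinates, `ϱ`, `L⁻² + γ‖σ‖∕ϱ`); as the ball grows the margin tends to the linear datum `L⁻²`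
  (`margin_tendsto`), and it is `< 1` as soon as `ϱ > γ‖σ‖∕(1 − L⁻²)` (`margin_lt_one`).
* §3 the renormalized trajectory of the caricature is EXPLICIT: `zStar L deg σ g = (g·σ i∕(1 − blockFactor L (deg i)))_i` is a fixed point of the step at coupling `g`
  (`wickBlockStepC_zStar`), hence — by (R53)'s `existsUnique_fixedPoint_of_strictInward` — THE fixed point in the ball (`zStar_unique`).
* §4 **`ne4_of_wickBlockC_margin`**: (R53)'s `ne4_of_strictInward` instantiated — every β-family read off the complexified block by a `cr`-Lipschitz functional has node
  U2's β-side triple at the EARLE–HAMILTON rate `2q∕(1+q)`; and `ehRate_gt_direct`: `L⁻² < 2q∕(1+q)` — the margin road is STRICTLY SLOWER than the direct computation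
  `stateContraction_wickBlock` ∕ `scaleShiftRate_wickBlock` of (R57) §5 (rate `L⁻²` itself), quantifying in the model (R53)'s caveat «the Earle–Hamilton rate is not sharp;
  the sharp rate stays ρ(T₀)⁺».

WHAT THIS SAYS FOR THE ROW (census (R57)(ii); classification words UNCHANGED): in the one explicit model the idea road's hypothesis is not only satisfiable but its
three numbers are formulas — norm = sup of complexified Wick coordinates, radius free, margin `L⁻² + (one-step source)∕radius`; what a NODE-O typer must exhibit for
Bałaban's RT is the analogue: a k-uniform norm on complexified activities whose Gaussian part is Wick-diagonal with factors `L^{4−dim}`, and a source small against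
`(1 − L⁻²)·radius`.  NOT PRINTED for lattice gauge theory; nothing of Bałaban's asserted; NE4 NOT proved.
-/

noncomputable section

namespace Summit.QuantumFields.BalabanUV.T4Continuum.Spine.NE4

open Literature.MathematicalPhysics.QuantumFieldTheory.Balaban1983to89.FlowStep (HBeta)
open Literature.MathematicalPhysics.QuantumFieldTheory.Balaban1983to89.T4CouplingMatching (ScaleShiftRate HistLipschitz FadingMemory)
open Metric Set Filter Topology

namespace GaussianBlock

variable {m : ℕ}

/-! ## §1 The complexified Wick block step: entire, with the norm bound `L⁻²‖z‖ + γ‖σ‖` -/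

section Step

/-- THE COMPLEXIFIED WICK BLOCK STEP on `Fin m → ℂ` (sup norm): coordinate `i` (Wick degree `deg i`) is multiplied by the Gaussian factor `L^{4 − deg i}` of
(R57) and shifted by the coupling-proportional one-step source `g·σ i`.  A caricature of (R42)'s `A g` on the irrelevant directions; NOT Bałaban's RT. [folklore] -/
def wickBlockStepC (L : ℝ) (deg : Fin m → ℕ) (σ : Fin m → ℝ) (g : ℝ) (z : Fin m → ℂ) : Fin m → ℂ :=
  fun i => (blockFactor L (deg i) : ℂ) * z i + ((g * σ i : ℝ) : ℂ)

/-- [bookkeeping] The step is ENTIRE in the state (affine in every coordinate). [folklore] -/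
theorem differentiable_wickBlockStepC (L : ℝ) (deg : Fin m → ℕ) (σ : Fin m → ℝ) (g : ℝ) :
    Differentiable ℂ (wickBlockStepC L deg σ g) :=
  differentiable_pi.2 fun i => ((differentiable_apply i).const_mul _).add_const _

/-- **THE NORM BOUND**: `‖A g z‖ ≤ L⁻²·‖z‖ + γ·‖σ‖` for `1 ≤ L`, all degrees `≥ 6`, `0 < g ≤ γ` (coordinatewise: `blockFactor ≤ L⁻²` by (R57)'s
`blockFactor_le_of_six_le`, `|g σ_i| ≤ γ‖σ‖`). [folklore] -/
theorem norm_wickBlockStepC_le {L : ℝ} (hL : 1 ≤ L) {deg : Fin m → ℕ} (hdeg : ∀ i, 6 ≤ deg i) (σ : Fin m → ℝ) {γ g : ℝ}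
    (hg0 : 0 < g) (hgγ : g ≤ γ) (z : Fin m → ℂ) :
    ‖wickBlockStepC L deg σ g z‖ ≤ L⁻¹ ^ 2 * ‖z‖ + γ * ‖σ‖ := by
  have hL0 : 0 < L := lt_of_lt_of_le one_pos hL
  have hγ : 0 ≤ γ := hg0.le.trans hgγ
  refine (pi_norm_le_iff_of_nonneg (by positivity)).2 fun i => ?_
  rw [wickBlockStepC]
  calc ‖(blockFactor L (deg i) : ℂ) * z i + ((g * σ i : ℝ) : ℂ)‖
      ≤ ‖(blockFactor L (deg i) : ℂ) * z i‖ + ‖((g * σ i : ℝ) : ℂ)‖ := norm_add_le _ _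
    _ = blockFactor L (deg i) * ‖z i‖ + g * |σ i| := by
        rw [norm_mul, Complex.norm_real, Real.norm_of_nonneg (blockFactor_pos hL0 _).le, Complex.norm_real, Real.norm_eq_abs,
          abs_mul, abs_of_pos hg0]
    _ ≤ L⁻¹ ^ 2 * ‖z‖ + γ * ‖σ‖ := by
        refine add_le_add (mul_le_mul (blockFactor_le_of_six_le hL (hdeg i)) (norm_le_pi_norm z i) (norm_nonneg _) (by positivity))
          (mul_le_mul hgγ ((Real.norm_eq_abs _).symm.trans_le (norm_le_pi_norm σ i)) (abs_nonneg _) hγ)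

end Step

/-! ## §2 The three numbers: (R53)'s strict inward mapping with norm = sup, any radius `ϱ`, margin `L⁻² + γ‖σ‖∕ϱ` -/

section Margin

/-- THE MARGIN OF THE MODEL at radius `ϱ`: `q(ϱ) = L⁻² + γ‖σ‖∕ϱ` — the linear datum plus the one-step source measured in units of the radius. [folklore] -/
def margin (L γ : ℝ) (σ : Fin m → ℝ) (ϱ : ℝ) : ℝ := L⁻¹ ^ 2 + γ * ‖σ‖ / ϱ

/-- **(R53)'s HYPOTHESIS HOLDS IN THE MODEL, WITH EXPLICIT NUMBERS**: for `1 ≤ L`, degrees `≥ 6`, any `ϱ > 0` and any `q ≥ L⁻² + γ‖σ‖∕ϱ`, the complexified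
Wick block step is a STRICT INWARD MAPPING of the sup-norm ball of radius `ϱ` with margin `q`: `Markov.StrictInward (wickBlockStepC L deg σ) ϱ q γ`.  (Useful
when `q < 1`, i.e. `ϱ > γ‖σ‖∕(1 − L⁻²)` — `margin_lt_one`.) [folklore] -/
theorem strictInward_wickBlockC {L : ℝ} (hL : 1 ≤ L) {deg : Fin m → ℕ} (hdeg : ∀ i, 6 ≤ deg i) (σ : Fin m → ℝ) {γ ϱ q : ℝ} (hϱ : 0 < ϱ)
    (hq : margin L γ σ ϱ ≤ q) : Markov.StrictInward (wickBlockStepC L deg σ) ϱ q γ := by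
  intro g hg0 hgγ
  refine ⟨(differentiable_wickBlockStepC L deg σ g).differentiableOn, fun z hz => ?_⟩
  rw [mem_ball, dist_zero_right] at hz
  rw [mem_closedBall, dist_zero_right]
  have hγ : 0 ≤ γ := hg0.le.trans hgγ
  have hq' : L⁻¹ ^ 2 * ϱ + γ * ‖σ‖ ≤ q * ϱ := by
    have := mul_le_mul_of_nonneg_right hq hϱ.le
    rwa [margin, add_mul, div_mul_cancel₀ _ hϱ.ne'] at this
  calc ‖wickBlockStepC L deg σ g z‖ ≤ L⁻¹ ^ 2 * ‖z‖ + γ * ‖σ‖ := norm_wickBlockStepC_le hL hdeg σ hg0 hgγ z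
    _ ≤ L⁻¹ ^ 2 * ϱ + γ * ‖σ‖ := by nlinarith [sq_nonneg L⁻¹]
    _ ≤ q * ϱ := hq'

/-- **THE MARGIN TENDS TO THE LINEAR DATUM AS THE BALL GROWS**: `q(ϱ) = L⁻² + γ‖σ‖∕ϱ → L⁻²` as `ϱ → ∞` (the model is affine, so the source is the only
obstruction and it is diluted by the radius). [folklore] -/
theorem margin_tendsto (L γ : ℝ) (σ : Fin m → ℝ) : Tendsto (margin L γ σ) atTop (𝓝 (L⁻¹ ^ 2)) := by
  have h : Tendsto (fun ϱ : ℝ => γ * ‖σ‖ / ϱ) atTop (𝓝 0) :=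
    (tendsto_const_nhds (x := γ * ‖σ‖)).div_atTop tendsto_id
  have h2 := (tendsto_const_nhds (x := L⁻¹ ^ 2)).add h
  rw [add_zero] at h2
  exact h2

/-- [bookkeeping] THE MARGIN IS `< 1` ON LARGE BALLS: for `1 < L`, `0 ≤ γ` and `ϱ > γ‖σ‖∕(1 − L⁻²)`, `margin L γ σ ϱ < 1`. [folklore] -/
theorem margin_lt_one {L : ℝ} (hL : 1 < L) {γ : ℝ} (hγ : 0 ≤ γ) (σ : Fin m → ℝ) {ϱ : ℝ} (hϱ : γ * ‖σ‖ / (1 - L⁻¹ ^ 2) < ϱ) :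
    margin L γ σ ϱ < 1 := by
  have hL0 : 0 < L := one_pos.trans hL
  have hinv : L⁻¹ ^ 2 < 1 := by
    have h1 : L⁻¹ < 1 := inv_lt_one_of_one_lt₀ hL
    have h0 : 0 ≤ L⁻¹ := (inv_pos.2 hL0).le
    nlinarith
  have hden : 0 < 1 - L⁻¹ ^ 2 := by linarith
  have hϱ0 : 0 < ϱ := lt_of_le_of_lt (div_nonneg (by positivity) hden.le) hϱ
  rw [margin, ← lt_sub_iff_add_lt', div_lt_iff₀ hϱ0]
  rw [div_lt_iff₀ hden] at hϱ
  linarith [mul_comm ϱ (1 - L⁻¹ ^ 2)]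

/-- [bookkeeping] The margin is at least the linear datum (`0 ≤ γ`, `0 < ϱ`): `L⁻² ≤ margin L γ σ ϱ`; in particular it is positive. [folklore] -/
theorem linear_le_margin (L : ℝ) {γ : ℝ} (hγ : 0 ≤ γ) (σ : Fin m → ℝ) {ϱ : ℝ} (hϱ : 0 < ϱ) : L⁻¹ ^ 2 ≤ margin L γ σ ϱ :=
  le_add_of_nonneg_right (div_nonneg (mul_nonneg hγ (norm_nonneg _)) hϱ.le)

end Margin

/-! ## §3 The renormalized trajectory of the caricature, explicitly -/

section FixedPoint

/-- THE FIXED POINT OF THE STEP AT COUPLING `g`: `z⋆_i = g·σ_i ∕ (1 − L^{4−deg i})` — the «renormalized trajectory» `g ↦ z⋆(g)` of the caricature, a LINEAR function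
of the coupling. [folklore] -/
def zStar (L : ℝ) (deg : Fin m → ℕ) (σ : Fin m → ℝ) (g : ℝ) : Fin m → ℂ :=
  fun i => ((g * σ i / (1 - blockFactor L (deg i)) : ℝ) : ℂ)

/-- **`z⋆(g)` IS A FIXED POINT** of `wickBlockStepC L deg σ g` (for `1 < L`, degrees `≥ 6`, so that every factor is `< 1`). [folklore] -/
theorem wickBlockStepC_zStar {L : ℝ} (hL : 1 < L) {deg : Fin m → ℕ} (hdeg : ∀ i, 6 ≤ deg i) (σ : Fin m → ℝ) (g : ℝ) :
    wickBlockStepC L deg σ g (zStar L deg σ g) = zStar L deg σ g := by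
  funext i
  have hlt : blockFactor L (deg i) < 1 := by
    have h1 : L⁻¹ < 1 := inv_lt_one_of_one_lt₀ hL
    have h0 : 0 ≤ L⁻¹ := (inv_pos.2 (one_pos.trans hL)).le
    have : L⁻¹ ^ 2 < 1 := by nlinarith
    exact lt_of_le_of_lt (blockFactor_le_of_six_le hL.le (hdeg i)) this
  have hne : (1 : ℝ) - blockFactor L (deg i) ≠ 0 := by linarith
  have key : blockFactor L (deg i) * (g * σ i / (1 - blockFactor L (deg i))) + g * σ i = g * σ i / (1 - blockFactor L (deg i)) := by
    field_simp
    ring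
  simp only [wickBlockStepC, zStar]
  exact_mod_cast key

/-- [bookkeeping] `z⋆(g)` lies in the ball of radius `ϱ` as soon as `g·‖σ‖ < (1 − L⁻²)·ϱ` (`0 ≤ g`, `1 < L`, degrees `≥ 6`). [folklore] -/
theorem zStar_mem_ball {L : ℝ} (hL : 1 < L) {deg : Fin m → ℕ} (hdeg : ∀ i, 6 ≤ deg i) (σ : Fin m → ℝ) {g ϱ : ℝ} (hg : 0 ≤ g)
    (hϱ : g * ‖σ‖ < (1 - L⁻¹ ^ 2) * ϱ) : zStar L deg σ g ∈ ball (0 : Fin m → ℂ) ϱ := by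
  have hL0 : 0 < L := one_pos.trans hL
  have hinv : L⁻¹ ^ 2 < 1 := by
    have h1 : L⁻¹ < 1 := inv_lt_one_of_one_lt₀ hL
    have h0 : 0 ≤ L⁻¹ := (inv_pos.2 hL0).le
    nlinarith
  have hden0 : 0 < 1 - L⁻¹ ^ 2 := by linarith
  have hϱ0 : 0 < ϱ :=
    (mul_pos_iff_of_pos_left hden0).mp (lt_of_le_of_lt (mul_nonneg hg (norm_nonneg σ)) hϱ)
  rw [mem_ball, dist_zero_right]
  refine lt_of_le_of_lt ((pi_norm_le_iff_of_nonneg (div_nonneg (mul_nonneg hg (norm_nonneg σ)) hden0.le)).2 fun i => ?_)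
    ((div_lt_iff₀ hden0).2 (by linarith [mul_comm ϱ (1 - L⁻¹ ^ 2)]))
  have hden : 0 < 1 - blockFactor L (deg i) := by linarith [blockFactor_le_of_six_le hL.le (hdeg i)]
  rw [zStar, Complex.norm_real, Real.norm_eq_abs, abs_div, abs_of_pos hden, abs_mul, abs_of_nonneg hg]
  calc g * |σ i| / (1 - blockFactor L (deg i)) ≤ g * ‖σ‖ / (1 - blockFactor L (deg i)) :=
        div_le_div_of_nonneg_right (mul_le_mul_of_nonneg_left ((Real.norm_eq_abs _).symm.trans_le (norm_le_pi_norm σ i)) hg) hden.le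
    _ ≤ g * ‖σ‖ / (1 - L⁻¹ ^ 2) :=
        div_le_div_of_nonneg_left (mul_nonneg hg (norm_nonneg σ)) hden0 (by linarith [blockFactor_le_of_six_le hL.le (hdeg i)])

/-- **`z⋆(g)` IS THE UNIQUE FIXED POINT IN THE BALL** — (R53)'s `Markov.existsUnique_fixedPoint_of_strictInward` (Earle–Hamilton) applied to §2's strict inward
mapping: any fixed point of the step at coupling `g ∈ ]0, γ]` in `ball 0 ϱ` IS `z⋆(g)` (`1 < L`, degrees `≥ 6`, `margin L γ σ ϱ ≤ q < 1`). [folklore] -/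
theorem zStar_unique {L : ℝ} (hL : 1 < L) {deg : Fin m → ℕ} (hdeg : ∀ i, 6 ≤ deg i) (σ : Fin m → ℝ) {γ ϱ q g : ℝ} (hϱ : 0 < ϱ)
    (hq : margin L γ σ ϱ ≤ q) (hq1 : q < 1) (hg0 : 0 < g) (hgγ : g ≤ γ) {z : Fin m → ℂ} (hz : z ∈ ball (0 : Fin m → ℂ) ϱ)
    (hfix : wickBlockStepC L deg σ g z = z) : z = zStar L deg σ g := by
  have hγ : 0 ≤ γ := hg0.le.trans hgγ
  have hq0 : 0 < q := lt_of_lt_of_le (lt_of_lt_of_le (by positivity) (linear_le_margin L hγ σ hϱ)) hq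
  have hSI := strictInward_wickBlockC hL.le hdeg σ hϱ hq
  obtain ⟨x, -, huniq⟩ := Markov.existsUnique_fixedPoint_of_strictInward hϱ hq0 hq1 hSI hg0 hgγ
  have hstar_mem : zStar L deg σ g ∈ ball (0 : Fin m → ℂ) ϱ := by
    refine zStar_mem_ball hL hdeg σ hg0.le ?_
    have h1 : g * ‖σ‖ ≤ γ * ‖σ‖ := mul_le_mul_of_nonneg_right hgγ (norm_nonneg σ)
    have h2 : L⁻¹ ^ 2 * ϱ + γ * ‖σ‖ ≤ q * ϱ := by
      have := mul_le_mul_of_nonneg_right hq hϱ.le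
      rwa [margin, add_mul, div_mul_cancel₀ _ hϱ.ne'] at this
    nlinarith
  rw [huniq z ⟨hz, hfix⟩, huniq (zStar L deg σ g) ⟨hstar_mem, wickBlockStepC_zStar hL hdeg σ g⟩]

end FixedPoint

/-! ## §4 NE4 via the margin road at the Earle–Hamilton rate, against the direct rate `L⁻²` -/

section Road

/-- [bookkeeping] THE COUPLING ENTERS LIPSCHITZ on every set: `dist (A g z) (A g′ z) ≤ ‖σ‖·|g − g′|`. [folklore] -/
theorem stateCouplingLipschitz_wickBlockC (L : ℝ) (deg : Fin m → ℕ) (σ : Fin m → ℝ) (S : Set (Fin m → ℂ)) (γ : ℝ) :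
    Markov.StateCouplingLipschitz (wickBlockStepC L deg σ) S ‖σ‖ γ := by
  intro g g' _ _ _ _ z _
  refine (dist_pi_le_iff (by positivity)).2 fun i => ?_
  rw [wickBlockStepC, wickBlockStepC, dist_eq_norm,
    show (blockFactor L (deg i) : ℂ) * z i + ((g * σ i : ℝ) : ℂ) - ((blockFactor L (deg i) : ℂ) * z i + ((g' * σ i : ℝ) : ℂ))
      = (((σ i * (g - g')) : ℝ) : ℂ) by push_cast; ring, Complex.norm_real, Real.norm_eq_abs, abs_mul]
  exact mul_le_mul_of_nonneg_right ((Real.norm_eq_abs _).symm.trans_le (norm_le_pi_norm σ i)) (abs_nonneg _)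

/-- **NE4 VIA THE MARGIN ROAD, IN THE MODEL**: with `1 ≤ L`, degrees `≥ 6`, `0 < ϱ`, `margin L γ σ ϱ ≤ q < 1`, a `cr`-Lipschitz read-out on the inner ball and a
β-family represented from the bare state `0`, (R53)'s `Markov.ne4_of_strictInward` gives node U2's β-side triple at the EARLE–HAMILTON rate `θ_EH = 2q∕(1+q)`:
`ScaleShiftRate (cr·(2∕(1−q))·(qϱ)·θ_EH) θ_EH γ β ∧ HistLipschitz Λ γ β ∧ FadingMemory (cr·(2∕(1−q))·‖σ‖) θ_EH Λ`.  Compare (R57) §5's DIRECT `scaleShiftRate_wickBlock`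
(real block, rate `L⁻²` itself): `ehRate_gt_direct`. [folklore] -/
theorem ne4_of_wickBlockC_margin {L : ℝ} (hL : 1 ≤ L) {deg : Fin m → ℕ} (hdeg : ∀ i, 6 ≤ deg i) (σ : Fin m → ℝ) {γ ϱ q cr : ℝ}
    (hϱ : 0 < ϱ) (hγ : 0 ≤ γ) (hq : margin L γ σ ϱ ≤ q) (hq1 : q < 1) (hcr : 0 ≤ cr) {r : (Fin m → ℂ) → ℝ} {β : HBeta}
    (hrep : Markov.RepresentsAut (wickBlockStepC L deg σ) r 0 γ β) (hr : Markov.ReadLipschitzOn r (closedBall (0 : Fin m → ℂ) (q * ϱ)) cr) :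
    ScaleShiftRate (cr * (2 / (1 - q)) * (q * ϱ) * (2 * q / (1 + q))) (2 * q / (1 + q)) γ β ∧
      HistLipschitz (fun k i => cr * (2 / (1 - q)) * ‖σ‖ * (2 * q / (1 + q)) ^ (k - i)) γ β ∧
      FadingMemory (cr * (2 / (1 - q)) * ‖σ‖) (2 * q / (1 + q)) (fun k i => cr * (2 / (1 - q)) * ‖σ‖ * (2 * q / (1 + q)) ^ (k - i)) :=
  have hq0 : 0 < q := lt_of_lt_of_le (lt_of_lt_of_le (by positivity [lt_of_lt_of_le one_pos hL]) (linear_le_margin L hγ σ hϱ)) hq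
  Markov.ne4_of_strictInward hϱ hq0 hq1 hcr (norm_nonneg σ) (strictInward_wickBlockC hL hdeg σ hϱ hq)
    (stateCouplingLipschitz_wickBlockC L deg σ _ γ) hrep hr

/-- **THE EARLE–HAMILTON LOSS, QUANTIFIED IN THE MODEL**: the margin road's rate `2q∕(1+q)` is STRICTLY WORSE than the direct rate `L⁻²` of (R57) §5 whenever
`q ≥ margin ≥ L⁻²` (`0 ≤ γ`, `0 < ϱ`, `q < 1`, `0 < L`): `L⁻² < 2q∕(1+q)` — (R53)'s caveat «the sharp rate stays ρ(T₀)⁺» with `ρ(T₀) = L⁻²` explicit. [folklore] -/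
theorem ehRate_gt_direct {L : ℝ} (hL : 0 < L) {γ : ℝ} (hγ : 0 ≤ γ) (σ : Fin m → ℝ) {ϱ q : ℝ} (hϱ : 0 < ϱ) (hq : margin L γ σ ϱ ≤ q)
    (hq1 : q < 1) : L⁻¹ ^ 2 < 2 * q / (1 + q) := by
  have hlin : L⁻¹ ^ 2 ≤ q := (linear_le_margin L hγ σ hϱ).trans hq
  have hq0 : 0 < q := lt_of_lt_of_le (by positivity) hlin
  exact lt_of_le_of_lt hlin (Markov.lt_ehRate_lt_one hq0 hq1).1

end Road

end GaussianBlock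

end Summit.QuantumFields.BalabanUV.T4Continuum.Spine.NE4
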